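import Literature.NumberTheory.Automorphic.GKModulesDixmierSchur                   -- ★ p830646 (A-p06 (g24)): N0 `upqCasimirOp_eq_algebraMap_of_isIrreducibleGK`, `exists_upqCasimirOp_harishChandra_eq_smul`
import Literature.NumberTheory.Automorphic.GKModulesAdCompatOfWeakDeriv             -- ★ `IsGKModule.apply_mem_of_K_stable_of_hasWeakDeriv` (`K`-stable ⇒ `𝔨`-stable)
import HarnessLib

/-!
# The `𝔭`-part `Σ_s ρ(x_s)²` of the Casimir preserves every `K`-stable subspace of a quasi-simple `(𝔤, K)`-module of `U(α, β)`

Topic `NumberTheory/Automorphic`; namespace `Literature.NumberTheory.Automorphic`; THEOREMS ONLY (no `def`, no named fact, no instance, no notation,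
no `sorry`).  Cell `hodgecm-mathlib`, F0∕P3, T1a arch line: node **N2** (filtration-free core) of the in-house road to the letter V19 ★
`IrreducibleUnitaryKTypeGrowth` at `U(2,1)` (LEAD F0P3b-p01 (g2) 2026-08-31T18:15:14Z «A-p06 takes N2»; skeleton draft
`F0/P3/Lines-draft/T1a_V19_KTypeGrowthPaydown.A-p06g24.lean`).

THE PRINT ([Varadarajan1989, §5.4, proof of Thm. 22 ∕ Lemma 21]; [KnappVogan1995, Prop. 4.87]; [BorelWallach2000, II §1.3 (1)–(2)]).  In a `(𝔤, K)`-module of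
`U(α, β)` the Casimir splits along the Cartan decomposition `𝔤 = 𝔨 ⊕ 𝔭` as `C = Σ_s ρ(x_s)² − Σ_a ρ(w_a)²` (orthonormal `(x_s)` of `𝔭`, pseudo-orthonormal
`(w_a)` of `𝔨`; ★ `upqCasimirOp_eq`).  If `C` acts by a scalar `c` (quasi-simplicity — for IRREDUCIBLE modules this is N0 ★ p830646, Dixmier, no admissibility),
then for every `K`-stable subspace `U` — which is automatically `𝔨`-stable (★ `IsGKModule.apply_mem_of_K_stable_of_hasWeakDeriv`) — the `𝔭`-PART
`Ω_𝔭 := Σ_s ρ(x_s)²` satisfies `Ω_𝔭 u = c u + Σ_a ρ(w_a)(ρ(w_a) u) ∈ U` for `u ∈ U`.  In the `𝔭`-filtration `F n = Σ_{k ≤ n} 𝔭^k · W₀` of N1 this is the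
statement «`q · Sym^{n−2}(𝔭_ℂ) ⊗ W₀ ↦ 0` in `F n ∕ F (n−1)`» (`q = Σ_s x_s²` the invariant quadric, `U := F (n−2)`), i.e. the graded pieces are quotients of
the HARMONICS `𝓗^n ⊗ W₀`.

THE LEAN TEXT (generic `(ρK, ρ𝔤)` on `V`, `U : Submodule ℂ V` with `hU : ∀ k, ∀ u ∈ U, ρK k u ∈ U`):
* `upq_apply_mem_of_kStable_of_mem_kInLie` — `ρ𝔤 Y u ∈ U` for `Y ∈ 𝔨` (`kInLie`); `upq_sum_kPart_mem_of_kStable` — `Σ_a ρ𝔤(w_a) (ρ𝔤(w_a) u) ∈ U`;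
* **`upq_sum_pPart_mem_of_kStable_of_casimir`** — if `upqCasimirOp ρ𝔤 = algebraMap ℂ _ c` then `Σ_s ρ𝔤(x_s) (ρ𝔤(x_s) u) ∈ U`; pointwise-scalar form
  `upq_sum_pPart_mem_of_kStable_of_casimir_smul` (`∀ v, C v = c • v`);
* **`upq_sum_pPart_mem_of_kStable_of_isIrreducibleGK`** — the same for every IRREDUCIBLE `(𝔤, K)`-module of `U(α, β)` (`V : Type`; N0 ★);
* **`upq_sum_pPart_harishChandra_mem_of_kStable`** — the same on the Harish-Chandra module `H_K^∞` of a unitary globalization of an irreducible class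
  (★ `harishChandraRepK` ∕ `harishChandraRepLie`; N0 ★ `exists_upqCasimirOp_harishChandra_eq_smul`), for `K`-stable `U ≤ H_K^∞`.
HONEST LABEL: closes no registered stub by itself (N2 of the V19 road; N1, N3, N4 open).  HC_CM is proved only modulo the 2 remaining named inputs
(hLiu418, h413) — behind them the booked printed statements + the MOD package — until rung 0 closes.

## References
* V. S. Varadarajan, *An Introduction to Harmonic Analysis on Semisimple Lie Groups* (1989), §5.4 (Lemma 21, proof of Thm. 22) [Varadarajan1989].
* A. W. Knapp, D. A. Vogan, *Cohomological Induction and Unitary Representations* (1995), Prop. 4.87 [KnappVogan1995].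
* A. Borel, N. Wallach, *Continuous cohomology, discrete subgroups, and representations of reductive groups*, 2nd ed. (2000), II §1.3 (1)–(2) [BorelWallach2000].
-/

-- Mathlib idiom (as in ★ `GKModules`, ★ `GKModulesSchur`, ★ `UpqCasimirTensor`): the commutator bracket on `Module.End ℂ V`, to MENTION `ρ𝔤 : 𝔤 →ₗ⁅ℝ⁆ End V`.
attribute [local instance 100] LieRing.ofAssociativeRing

set_option autoImplicit false

noncomputable section

namespace Literature.NumberTheory.Automorphic

open Literature.RepresentationTheory.BorelWallach2000
open Literature.RepresentationTheory.KonnoKonno2007 Literature.RepresentationTheory.KonnoKonno2007.RealDualPair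

variable {α β : Type*} [Fintype α] [DecidableEq α] [Fintype β] [DecidableEq β]

/-! ## §1 `K`-stable subspaces are stable under `𝔨` and under the `𝔨`-part of the Casimir -/

section KPart

variable {V : Type*} [AddCommGroup V] [Module ℂ V]
  (ρK : Representation ℂ (uFormGroup α β).maximalCompact V) (ρ𝔤 : (uFormGroup α β).lie →ₗ⁅ℝ⁆ Module.End ℂ V)

/-- **A `K`-stable subspace of a `(𝔤, K)`-module is `𝔨`-stable**: `ρ𝔤 Y u ∈ U` for `Y ∈ 𝔨 = kInLie` (★ `IsGKModule.apply_mem_of_K_stable_of_hasWeakDeriv`,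
`kInLie` being the range of `𝔨 ↪ 𝔤`). [cite: BorelWallach2000, 0 §2.5] [cite: Varadarajan1989, §5.4] -/
theorem upq_apply_mem_of_kStable_of_mem_kInLie (hV : IsGKModule (uFormGroup α β) ρK ρ𝔤) {U : Submodule ℂ V}
    (hU : ∀ (k : (uFormGroup α β).maximalCompact), ∀ u ∈ U, ρK k u ∈ U) (Y : (uFormGroup α β).lie) (hY : Y ∈ (uFormGroup α β).kInLie)
    {u : V} (hu : u ∈ U) : ρ𝔤 Y u ∈ U := by
  obtain ⟨Z, rfl⟩ := (LieHom.mem_range _ Y).mp hY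
  exact IsGKModule.apply_mem_of_K_stable_of_hasWeakDeriv hV.hasWeakDeriv Z hU hu

/-- The `𝔨`-part of the Casimir preserves `K`-stable subspaces: `Σ_a ρ𝔤(w_a) (ρ𝔤(w_a) u) ∈ U`. [cite: BorelWallach2000, II §1.3 (2)] -/
theorem upq_sum_kPart_mem_of_kStable (hV : IsGKModule (uFormGroup α β) ρK ρ𝔤) {U : Submodule ℂ V}
    (hU : ∀ (k : (uFormGroup α β).maximalCompact), ∀ u ∈ U, ρK k u ∈ U) {u : V} (hu : u ∈ U) :
    (∑ a, ρ𝔤 (upqKVec α β a) (ρ𝔤 (upqKVec α β a) u)) ∈ U :=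
  U.sum_mem fun a _ =>
    upq_apply_mem_of_kStable_of_mem_kInLie ρK ρ𝔤 hV hU _ (upqKVec_mem a)
      (upq_apply_mem_of_kStable_of_mem_kInLie ρK ρ𝔤 hV hU _ (upqKVec_mem a) hu)

/-! ## §2 The `𝔭`-part of a scalar Casimir preserves `K`-stable subspaces -/

/-- **N2 CORE.**  If the Casimir ★ `upqCasimirOp ρ𝔤 = Σ_s ρ(x_s)² − Σ_a ρ(w_a)²` acts by the scalar `c` then its `𝔭`-part preserves every `K`-stable
subspace: `Σ_s ρ𝔤(x_s) (ρ𝔤(x_s) u) = c u + Σ_a ρ𝔤(w_a) (ρ𝔤(w_a) u) ∈ U` — «`q · Sym^{n−2}(𝔭) ⊗ W₀ ↦ 0` in `F n ∕ F (n−1)`» for the `𝔭`-filtration of N1.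
[cite: Varadarajan1989, §5.4 (proof of Thm. 22)] [cite: BorelWallach2000, II §1.3 (1)–(2)] -/
theorem upq_sum_pPart_mem_of_kStable_of_casimir (hV : IsGKModule (uFormGroup α β) ρK ρ𝔤) {c : ℂ}
    (hC : upqCasimirOp ρ𝔤 = algebraMap ℂ (Module.End ℂ V) c) {U : Submodule ℂ V}
    (hU : ∀ (k : (uFormGroup α β).maximalCompact), ∀ u ∈ U, ρK k u ∈ U) {u : V} (hu : u ∈ U) :
    (∑ s, ρ𝔤 (upqPBasis s) (ρ𝔤 (upqPBasis s) u)) ∈ U := by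
  -- `Σ_s ρ(x_s)² = C + Σ_a ρ(w_a)²` as operators
  have hsplit : (∑ s : (α × β) × Fin 2, ρ𝔤 (upqPBasis s) * ρ𝔤 (upqPBasis s)) =
      upqCasimirOp ρ𝔤 + ∑ a, ρ𝔤 (upqKVec α β a) * ρ𝔤 (upqKVec α β a) := by
    rw [upqCasimirOp_eq ρ𝔤, sub_add_cancel]
  have happly := LinearMap.congr_fun hsplit u
  simp only [LinearMap.sum_apply, Module.End.mul_apply, LinearMap.add_apply] at happly
  rw [happly, hC, Module.algebraMap_end_apply]
  exact U.add_mem (U.smul_mem c hu) (upq_sum_kPart_mem_of_kStable ρK ρ𝔤 hV hU hu)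

/-- Pointwise-scalar form: if `C v = c • v` for all `v` then `Σ_s ρ𝔤(x_s) (ρ𝔤(x_s) u) ∈ U` for every `K`-stable `U ∋ u`.
[cite: Varadarajan1989, §5.4 (proof of Thm. 22)] -/
theorem upq_sum_pPart_mem_of_kStable_of_casimir_smul (hV : IsGKModule (uFormGroup α β) ρK ρ𝔤) {c : ℂ}
    (hC : ∀ v : V, upqCasimirOp ρ𝔤 v = c • v) {U : Submodule ℂ V}
    (hU : ∀ (k : (uFormGroup α β).maximalCompact), ∀ u ∈ U, ρK k u ∈ U) {u : V} (hu : u ∈ U) :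
    (∑ s, ρ𝔤 (upqPBasis s) (ρ𝔤 (upqPBasis s) u)) ∈ U :=
  upq_sum_pPart_mem_of_kStable_of_casimir ρK ρ𝔤 hV (c := c)
    (LinearMap.ext fun v => by rw [hC v, Module.algebraMap_end_apply]) hU hu

/-- The `𝔭`-part acts on `u ∈ U` as `c u` modulo the `𝔨`-part: `Σ_s ρ𝔤(x_s) (ρ𝔤(x_s) u) − c • u ∈ U` (same hypotheses; the form N4 uses to compare graded
pieces). [cite: Varadarajan1989, §5.4 (proof of Thm. 22)] -/
theorem upq_sum_pPart_sub_smul_mem_of_kStable_of_casimir (hV : IsGKModule (uFormGroup α β) ρK ρ𝔤) {c : ℂ}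
    (hC : upqCasimirOp ρ𝔤 = algebraMap ℂ (Module.End ℂ V) c) {U : Submodule ℂ V}
    (hU : ∀ (k : (uFormGroup α β).maximalCompact), ∀ u ∈ U, ρK k u ∈ U) {u : V} (hu : u ∈ U) :
    (∑ s, ρ𝔤 (upqPBasis s) (ρ𝔤 (upqPBasis s) u)) - c • u ∈ U :=
  U.sub_mem (upq_sum_pPart_mem_of_kStable_of_casimir ρK ρ𝔤 hV hC hU hu) (U.smul_mem c hu)

end KPart

/-! ## §3 Read-backs: irreducible modules (N0) and the Harish-Chandra module of a unitary globalization -/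

section Irreducible

variable {V : Type} [AddCommGroup V] [Module ℂ V]
  (ρK : Representation ℂ (uFormGroup α β).maximalCompact V) (ρ𝔤 : (uFormGroup α β).lie →ₗ⁅ℝ⁆ Module.End ℂ V)

/-- **N2 for IRREDUCIBLE `(𝔤, K)`-modules of `U(α, β)`** (carrier in `Type`): the `𝔭`-part `Σ_s ρ(x_s)²` of the Casimir preserves every `K`-stable subspace —
the Casimir is a scalar by N0 ★ `upqCasimirOp_eq_algebraMap_of_isIrreducibleGK` (Dixmier, no admissibility). [cite: Varadarajan1989, §5.4 (proof of Thm. 22)]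
[cite: KnappVogan1995, Prop. 4.87] -/
theorem upq_sum_pPart_mem_of_kStable_of_isIrreducibleGK (hV : IsGKModule (uFormGroup α β) ρK ρ𝔤) (hirr : IsIrreducibleGK ρK ρ𝔤)
    {U : Submodule ℂ V} (hU : ∀ (k : (uFormGroup α β).maximalCompact), ∀ u ∈ U, ρK k u ∈ U) {u : V} (hu : u ∈ U) :
    (∑ s, ρ𝔤 (upqPBasis s) (ρ𝔤 (upqPBasis s) u)) ∈ U := by
  obtain ⟨c, hc⟩ := upqCasimirOp_eq_algebraMap_of_isIrreducibleGK hV hirr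
  exact upq_sum_pPart_mem_of_kStable_of_casimir ρK ρ𝔤 hV hc hU hu

end Irreducible

section HarishChandra

/-- **N2 ON THE HARISH-CHANDRA MODULE of a unitary globalization of an irreducible class of `U(α, β)`**: for every `K`-stable subspace `U ≤ H_K^∞`
(`K` acting by ★ `harishChandraRepK`) and `u ∈ U`, `Σ_s dϖ(x_s) (dϖ(x_s) u) ∈ U` (★ `harishChandraRepLie`; Casimir scalar by N0 ★
`exists_upqCasimirOp_harishChandra_eq_smul`, the `(𝔤, K)`-axioms by ★ `isGKModule_harishChandra_holds`). [cite: Varadarajan1989, §5.4 (proof of Thm. 22)]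
[cite: KnappVogan1995, Prop. 4.87] -/
theorem upq_sum_pPart_harishChandra_mem_of_kStable {x : GKIrrClass (uFormGroup α β)}
    {E : Type} [NormedAddCommGroup E] [InnerProductSpace ℂ E] [CompleteSpace E]
    {ϖ : ContRepresentation ℂ (uFormGroup α β).carrier E} (hϖ : IsUnitaryGlobalization (uFormGroup α β) x ϖ)
    {U : Submodule ℂ (harishChandraSpace (uFormGroup α β) ϖ)}
    (hU : ∀ (k : (uFormGroup α β).maximalCompact), ∀ u ∈ U, harishChandraRepK (uFormGroup α β) ϖ k u ∈ U)
    {u : harishChandraSpace (uFormGroup α β) ϖ} (hu : u ∈ U) :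
    (∑ s, harishChandraRepLie (uFormGroup α β) ϖ hϖ.isStronglyContinuous (upqPBasis s)
        (harishChandraRepLie (uFormGroup α β) ϖ hϖ.isStronglyContinuous (upqPBasis s) u)) ∈ U := by
  have hV : IsGKModule (uFormGroup α β) (harishChandraRepK (uFormGroup α β) ϖ)
      (harishChandraRepLie (uFormGroup α β) ϖ hϖ.isStronglyContinuous) :=
    isGKModule_harishChandra_holds (uFormGroup α β) ϖ hϖ.isStronglyContinuous (harishChandraRepK (uFormGroup α β) ϖ)
      (fun _ _ => rfl) (isHarishChandraModuleOf_harishChandraRepLie (uFormGroup α β) ϖ hϖ.isStronglyContinuous)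
  obtain ⟨c, hc⟩ := exists_upqCasimirOp_harishChandra_eq_smul hϖ
  exact upq_sum_pPart_mem_of_kStable_of_casimir_smul (harishChandraRepK (uFormGroup α β) ϖ)
    (harishChandraRepLie (uFormGroup α β) ϖ hϖ.isStronglyContinuous) hV hc hU hu

end HarishChandra

end Literature.NumberTheory.Automorphic

end
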